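import Summits.KontsevichZagierPeriods.KontsevichZagierPeriods.Theorems.LinRedNormalFormArrangementNormalFormStubRebaseSimplePosOnePosParThinQuadCell

/-!
# Stub `stub_rebaseSimplePosOnePos` (crux `ArrangementNormalForm`, line `janus-bands`) —
part `ParFlatDep`: flat cells with DEPENDENT height and width are closed (any base dimension)

A complement to parts `Flats` … `ParThinQuadCell`. For the data of `Hpar` (parallel transverse
bands, letter `0`, common slope `s ≠ 0`, base pole `1/(y − ℓ₂(x'))`) over a product cell
`{x'-rows M₀} × (ylo(x'), yhi(x'))` whose closed cell contains a FLAT point (`h = w = 0`,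
`h = yhi − ylo` the height of the `y`-range, `w = v − u` the `y`-free width): if the linear
parts of the two `x'`-forms `h` and `w` are linearly dependent (`hdep`: `h_lin = c w_lin` or
`w_lin = c h_lin`), then `h = c w` resp. `w = c h` identically (both vanish at the flat point),
the constant is positive on a non-empty cell, and finitely many level splits close the band
(`RebasePos.good_parLevel` with `N = ⌈|s| c⌉` resp. `⌈|s|/c⌉`): `RebasePos.good_parCell_of_flat_dep`,
registered as `rebaseSimplePos_par_flatDep`. Consequently the residual flat / triple / quadruple
cells of parts `Flats`, `ParTripleFlat`, `ParThinQuadCell` may be assumed to have linearly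
INDEPENDENT height and width; for `B = 2` the flat locus of such a cell is then the single
rational point `x'₀` where `h = w = 0` (all triple and quadruple points coincide with it).

References: M. Kontsevich, D. Zagier, *Periods* (2001), §1.2, rule (1a).
-/

noncomputable section

open Set MeasureTheory MvPolynomial
open Literature.NumberTheory.Transcendental Literature.ModelTheory.ExponentialFields

namespace Summit.KontsevichZagierPeriods.ArrangementNormalForm.JanusBands

namespace RebasePos

open SeparatePos

section FlatDep

variable {B m m' m₀ : ℕ} (L : Fin m → (Fin B → ℚ) × ℚ) (e : Fin m → ℕ) (ℓ₁ ℓ₂ : (Fin B → ℚ) × ℚ)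

/-- Two `x'`-forms with proportional linear parts that vanish at a common point are
proportional. -/
theorem affB_eq_mul_of_dep (d d' : (Fin B → ℚ) × ℚ) (c : ℚ) (h1 : d.1 = c • d'.1)
    (z₀ : Fin (B + 1 + 1) → ℝ) (hd : affB B 1 d z₀ = 0) (hd' : affB B 1 d' z₀ = 0) (z : Fin (B + 1 + 1) → ℝ) :
    affB B 1 d z = (c : ℝ) * affB B 1 d' z := by
  set g : (Fin B → ℚ) × ℚ := d - c • d' with hg
  have hg1 : g.1 = 0 := by rw [hg, Prod.fst_sub, Prod.smul_fst, h1, sub_self]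
  have hconst : ∀ w : Fin (B + 1 + 1) → ℝ, affB B 1 g w = g.2 := fun w => by simp [affB, hg1]
  have hgz : ∀ w : Fin (B + 1 + 1) → ℝ, affB B 1 g w = affB B 1 d w - (c : ℝ) * affB B 1 d' w := fun w => by
    rw [hg, affB_sub, affB_smul']
  have h0 : (g.2 : ℝ) = 0 := by rw [← hconst z₀, hgz, hd, hd', mul_zero, sub_zero]
  have h := hgz z
  rw [hconst, h0] at h
  linarith

/-- **A flat product cell with dependent height and width is closed** (any base dimension).
Data of `Hpar` over a product cell (`hsec`) whose closed cell contains a flat point (`hfl`), the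
linear parts of `h = yhi − ylo` and `w = v − u` being linearly dependent (`hdep`): `[s]` is
congruent modulo `KZ.relations` to the subgroup generated by `GG B 2 1` (level splits). -/
theorem good_parCell_of_flat_dep (s : KZ.IntegralRep (B + 1 + 1)) (M : Fin m' → (Fin (B + 1) → ℚ) × ℚ)
    (M₀ : Fin m₀ → (Fin B → ℚ) × ℚ) (ylo yhi : (Fin B → ℚ) × ℚ) (p : MvPolynomial (Fin B) ℚ)
    (u v : (Fin (B + 1) → ℚ) × ℚ) (hbd : Bornology.IsBounded s.domain)
    (hdom : s.domain = gDom B 1 m' M (fun _ => Sum.inr u) (fun _ => Sum.inr v))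
    (hint : EqOn s.integrand (glit B 1 p L e ℓ₁ ℓ₂ 0 1 (fun _ => some 0)) s.domain)
    (hpar : u.1 (Fin.last B) = v.1 (Fin.last B))
    (hcell : ∀ z : Fin (B + 1 + 1) → ℝ, (∀ j, 0 < affF B 1 (M j) z) → 0 < affF B 1 u z ∧ affF B 1 u z < affF B 1 v z)
    (hsec : ∀ z : Fin (B + 1 + 1) → ℝ, (∀ j, 0 < affF B 1 (M j) z) ↔ ((∀ j, 0 < affB B 1 (M₀ j) z) ∧
      affB B 1 ylo z < z (Fin.castAdd 1 (Fin.last B)) ∧ z (Fin.castAdd 1 (Fin.last B)) < affB B 1 yhi z))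
    (hfl : ∃ z ∈ closure {z : Fin (B + 1 + 1) → ℝ | ∀ j, 0 < affF B 1 (M j) z},
      affB B 1 ylo z = affB B 1 yhi z ∧ affF B 1 u z = affF B 1 v z)
    (hdep : ∃ c : ℚ, (yhi - ylo).1 = c • (restr B v - restr B u).1 ∨ (restr B v - restr B u).1 = c • (yhi - ylo).1) :
    ∃ c ∈ AddSubgroup.closure (GGset B 2 1), KZ.of s - c ∈ KZ.relations := by
  set sR : ℝ := (u.1 (Fin.last B) : ℝ) with hsR
  set hF : (Fin B → ℚ) × ℚ := yhi - ylo with hhF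
  set wF : (Fin B → ℚ) × ℚ := restr B v - restr B u with hwF
  have hhz : ∀ z : Fin (B + 1 + 1) → ℝ, affB B 1 hF z = affB B 1 yhi z - affB B 1 ylo z :=
    fun z => by rw [hhF, affB_sub]
  have hwz : ∀ z : Fin (B + 1 + 1) → ℝ, affB B 1 wF z = affF B 1 v z - affF B 1 u z :=
    fun z => by rw [hwF, affB_sub, width_eq u v hpar]
  obtain ⟨z₀, -, h10, h20⟩ := hfl
  have hh0 : affB B 1 hF z₀ = 0 := by rw [hhz, h10, sub_self]
  have hw0 : affB B 1 wF z₀ = 0 := by rw [hwz, h20, sub_self]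
  -- an empty base cell
  by_cases hemp : ∀ z : Fin (B + 1 + 1) → ℝ, ¬ (∀ j, 0 < affF B 1 (M j) z)
  · refine good_of_null s ?_
    rw [hdom]
    exact measure_mono_null (fun z hz => (hemp z ((mem_gDom_one M u v z).1 hz).1).elim) measure_empty
  push Not at hemp
  obtain ⟨z₁, hz₁⟩ := hemp
  obtain ⟨-, hlo₁, hhi₁⟩ := (hsec z₁).1 hz₁
  obtain ⟨-, huv₁⟩ := hcell z₁ hz₁
  have hh1 : 0 < affB B 1 hF z₁ := by rw [hhz]; linarith
  have hw1 : 0 < affB B 1 wF z₁ := by rw [hwz]; linarith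
  obtain ⟨c, hc⟩ := hdep
  rcases hc with hc | hc
  · -- `h = c w`
    have hprop : ∀ z : Fin (B + 1 + 1) → ℝ, affB B 1 hF z = (c : ℝ) * affB B 1 wF z :=
      affB_eq_mul_of_dep hF wF c hc z₀ hh0 hw0
    have hc0 : (0 : ℝ) < c := by
      have h := hprop z₁
      nlinarith
    set N : ℕ := ⌈|sR| * c⌉₊ with hN
    have hNr : |sR| * c ≤ (N : ℝ) := Nat.le_ceil _
    refine good_parLevel L e ℓ₁ ℓ₂ 0 1 M₀ yhi p u v (Or.inl rfl) hpar N s M ylo hbd hdom hint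
      (fun z hz => (hsec z).1 hz) fun z hz => ?_
    obtain ⟨-, huv⟩ := hcell z hz
    have hw : 0 < affB B 1 wF z := by rw [hwz]; linarith
    rw [← hhz, ← hwz, hprop, ← hsR]
    calc |sR| * ((c : ℝ) * affB B 1 wF z) = (|sR| * c) * affB B 1 wF z := by ring
      _ ≤ (N : ℝ) * affB B 1 wF z := mul_le_mul_of_nonneg_right hNr hw.le
      _ ≤ ((N : ℝ) + 1) * affB B 1 wF z := by nlinarith
  · -- `w = c h`
    have hprop : ∀ z : Fin (B + 1 + 1) → ℝ, affB B 1 wF z = (c : ℝ) * affB B 1 hF z :=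
      affB_eq_mul_of_dep wF hF c hc z₀ hw0 hh0
    have hc0 : (0 : ℝ) < c := by
      have h := hprop z₁
      nlinarith
    set N : ℕ := ⌈|sR| / c⌉₊ with hN
    have hNr : |sR| ≤ (N : ℝ) * c := by
      have h := Nat.le_ceil (|sR| / c)
      rw [← hN, div_le_iff₀ hc0] at h
      exact h
    refine good_parLevel L e ℓ₁ ℓ₂ 0 1 M₀ yhi p u v (Or.inl rfl) hpar N s M ylo hbd hdom hint
      (fun z hz => (hsec z).1 hz) fun z hz => ?_
    obtain ⟨-, hlo, hhi⟩ := (hsec z).1 hz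
    have hh : 0 < affB B 1 hF z := by rw [hhz]; linarith
    rw [← hhz, ← hwz, hprop, ← hsR]
    calc |sR| * affB B 1 hF z ≤ (N : ℝ) * c * affB B 1 hF z := mul_le_mul_of_nonneg_right hNr hh.le
      _ = (N : ℝ) * ((c : ℝ) * affB B 1 hF z) := by ring
      _ ≤ ((N : ℝ) + 1) * ((c : ℝ) * affB B 1 hF z) := by nlinarith [mul_pos hc0 hh]

end FlatDep

end RebasePos

/-- **Registered part of `stub_rebaseSimplePosOnePos`, residual hypothesis `Hpar` (line
`janus-bands`): a FLAT product cell whose height and width have linearly dependent linear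
parts is closed** (any base dimension). Data of `Hpar` over a product cell
`{x'-rows M₀} × (ylo, yhi)` (`hsec`) whose closed cell contains a point with `ylo = yhi` and
`u = v`; if the linear parts of `yhi − ylo` and of the `y`-free width `v − u` are proportional
(`hdep`), then `yhi − ylo` and `v − u` are proportional with a positive constant and
`⌈|s| c⌉ + 1` level splits put `[s]` in `closure (GG B 2 1)` modulo `KZ.relations`
(`RebasePos.good_parCell_of_flat_dep`). -/
theorem rebaseSimplePos_par_flatDep (B m m' m₀ : ℕ) (s : KZ.IntegralRep (B + 1 + 1)) (M : Fin m' → (Fin (B + 1) → ℚ) × ℚ) (M₀ : Fin m₀ → (Fin B → ℚ) × ℚ) (ylo yhi : (Fin B → ℚ) × ℚ) (L : Fin m → (Fin B → ℚ) × ℚ) (e : Fin m → ℕ) (p : MvPolynomial (Fin B) ℚ) (ℓ₁ ℓ₂ : (Fin B → ℚ) × ℚ) (u v : (Fin (B + 1) → ℚ) × ℚ) (hbd : Bornology.IsBounded s.domain) (hdom : s.domain = SeparatePos.gDom B 1 m' M (fun _ => Sum.inr u) (fun _ => Sum.inr v)) (hint : Set.EqOn s.integrand (RebasePos.glit B 1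 p L e ℓ₁ ℓ₂ 0 1 (fun _ => some 0)) s.domain) (hpar : u.1 (Fin.last B) = v.1 (Fin.last B)) (hcell : ∀ z : Fin (B + 1 + 1) → ℝ, (∀ j, 0 < SeparatePos.affF B 1 (M j) z) → 0 < SeparatePos.affF B 1 u z ∧ SeparatePos.affF B 1 u z < SeparatePos.affF B 1 v z) (hsec : ∀ z : Fin (B + 1 + 1) → ℝ, (∀ j, 0 < SeparatePos.affF B 1 (M j) z) ↔ ((∀ j, 0 < SeparatePos.affB B 1 (M₀ j) z) ∧ SeparatePos.affB B 1 ylo z < z (Fin.castAdd 1 (Fin.last B)) ∧ z (Fin.castAdd 1 (Fin.last B)) < SeparatePos.affB B 1 yhi z)) (hfl : ∃ z ∈ closure {z : Fin (B + 1 + 1) → ℝ | ∀ j, 0 < SeparatePos.affF B 1 (M j) z}, SeparatePos.affB B 1 ylo z = SeparatePos.affB B 1 yhi z ∧ SeparatePos.affF B 1 u z = SeparatePos.affF B 1 v z) (hdep : ∃ c : ℚ, (yhi - ylo).1 = c • (SeparatePos.restr B v - SeparatePos.restr B u).1 ∨ (SeparatePos.restr B v - SeparatePos.restr B u).1 = c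 • (yhi - ylo).1) : ∃ c ∈ AddSubgroup.closure (SeparatePos.GGset B 2 1), KZ.of s - c ∈ KZ.relations :=
  RebasePos.good_parCell_of_flat_dep L e ℓ₁ ℓ₂ s M M₀ ylo yhi p u v hbd hdom hint hpar hcell hsec hfl hdep

end Summit.KontsevichZagierPeriods.ArrangementNormalForm.JanusBands
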